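import Summits.ABC.IUTFork.Cor312LicenceOfMultiReach
import Summits.ABC.IUTFork.Cor312StatementBridge
import Summits.ABC.IUTFork.Cor312VolumeVehiclesMono
import HarnessLib

/-!
# R-H ROUND 1 row 27 «reach-ledger» — the lemma L1 «mover reach ⟹ cell slack», VOLUME FORM, at `settingPrVolSharp`

PROOF-ONLY file (0 definitions, 0 `Prop` facts; abc-iut cell, D-0079 RESCUE sub-cell R-H, rung LADDER-ABC:A2.RESCUE.H;
pair n = 10 typer abc-iut-rh-typ-10, answering the R-H lead's question «is L1 typable as a crux?» for the late row 27
`Repair.RH.ReachLedger.HStarReachLedger` of abc-iut-lens-nearmiss-1). TAKES NO SIDE on [IUTchIII] Cor. 3.12 or on any author;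
typed ≠ proved; instantiated ≠ endorsed; nothing here asserts abc proved or refuted.

THE QUESTION. Row 27's k2 route (CARD-reach-ledger.md, door (b)) rides on a NEW lemma L1 «if at the cell `(x ∣ p, i)` the
Ism-movers reach `s` `w`-units beyond (`s ≥ 0`) / short of (`s < 0`) the q-pilot coordinate, then the CELL SLACK
`σ_{i+1,p} := logvol(ⁿ˒°𝒰_{i+1,p}) − qLocal_{i+1,p}` (abc-iut-rp-s2 `Repair.ObstructionSS28Window`, spelled out) is `≥ ⌊s/e_x⌋`
levels», declared «NOT in the tree».

THE ANSWER (this file). L1 is TYPABLE over the tree's vocabulary and — in its honest VOLUME FORM — it is NOT crux-sized: it is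
abc-iut-w5-d107's packet inclusion `Thm311.Real.qRegion_subset_thetaHull_settingDHVolSharp_of_multiReach` applied to the REACHED
q-idele `t_q'` (any idele the movers reach, in place of `t_q`), followed by monotonicity of the log-volume (`Cor312Vol.LogvolMono`,
a field of abc-iut-c312-6's `BridgeHyps`, discharged at this bed by abc-iut-c312-7's `bridgeHyps_settingPrVolSharp` from `ThetaFinite`)
and abc-iut-c312-7's two box-volume formulas `logvol_qRegion_Pr_inr`. The holomorphic hull `ⁿ˒°𝒰_{i+1,p}` of
`settingPrVolSharp` does not depend on the q-idele (`thetaHull_settingPrVolSharp_eq`, `rfl`).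
* `reachedQVolume_le_logvol_thetaHull` — MULTI-REACH of `t_q'` at the packet `(i+1, p)` ⟹
  `Σ_{v⃗} Pr(v⃗)·log ‖t_q'(v_{i+1})‖ ≤ logvol(ⁿ˒°𝒰_{i+1,p})`;
* `reachGain_le_cellSlack` — hence `Σ_{v⃗} Pr(v⃗)·(log ‖t_q'(v_{i+1})‖ − log ‖t_q(v_{i+1})‖) ≤ σ_{i+1,p}` (L1, volume form:
  the REACH GAIN in volume currency is a lower bound for the cell slack; a deficit is a negative gain);
* `levels_le_cellSlack` — the CARD's integer form: if `‖t_q'(x)‖ = ‖t_q(x)‖·p^{s_x/e_x}` at every `x ∣ p` (`s_x ∈ ℤ` `w`-units,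
  `e_x ≥ 1`), then `log p · Σ_{v⃗} Pr(v⃗)·⌊s/e⌋(v_{i+1}) ≤ σ_{i+1,p}` (`Pr ≥ 0`, `⌊s/e⌋ ≤ s/e`).
WHAT REMAINS row 27's business (not claimed here): (α) that the ledger's integers `cellReachSlack` are REALISED by movers (the
rows-15/20 attainment, `Repair.RHSlotReachGlue` lineage) and (β) the label bookkeeping from the per-place ledger to
`ObstructionSS28Window.statement_iff_avg_cellSlack`. [cite: DupuyHilado2025, §3.9, §4.9]
[cite: Mochizuki2012, IUTchIII Cor. 3.12 p.173–174; Rmk. 3.9.5 (i) p. 127] [claim: Mochizuki2012, status: disputed]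
-/

noncomputable section

open Set Function
open scoped Pointwise

namespace Summit.ABC.IUTFork.Repair.RH.ReachLedgerVolume

open Cor312 Cor312Vol Literature.IUT.LogThetaLattice Literature.IUT.LogVolume NumberField IsDedekindDomain
  Summit.ABC.IUTFork.Thm311 Summit.ABC.IUTFork.Thm311.Real


variable {F : Type} [Field F] [NumberField F] (X : PilotData F) {logv : PadicLogs F} (hlog : LogvAnalytic logv)
  (M : Type) [Field M] [NumberField M]
  (archPk : ∀ (j : (thetaIndex X).Label) (vQ : (thetaIndex X).VQ), Set ((logShellsDH X logv).Packet j vQ))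
  (archSub : ∀ (j : (thetaIndex X).Label) (v : (thetaIndex X).V),
    Set ((logShellsDH X logv).Packet j ((thetaIndex X).over v)))
  (Ψ : ℤ → ∀ v : (thetaIndex X).V, v ∈ (thetaIndex X).Vbad → Set ((logShellsDH X logv).StarPacket v))
  (act : ℤ → ∀ v : (thetaIndex X).V, v ∈ (thetaIndex X).Vbad →
    (logShellsDH X logv).StarPacket v → Module.End ℚ ((logShellsDH X logv).StarPacket v))
  (Mmod : ℤ → ∀ j : (thetaIndex X).LabelStar, Set ((logShellsDH X logv).GlobalPacket j.1))
  (region : ℤ → ∀ j : (thetaIndex X).LabelStar, FinDivisor M → ∀ vQ : (thetaIndex X).VQ,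
    Set ((logShellsDH X logv).Packet j.1 vQ))
  (n : ℤ) {HT : Type} {LogLink : HT → HT → Type} {IsFull : ∀ {s t : HT}, LogLink s t → Prop}
  (lat : LGPGaussianLogThetaLattice LogLink IsFull)
  {Frd : Type} {IsoF : Frd → Frd → Type} {Ob : Frd → Type} {realify : Frd → Frd} {Strip : Type}
  {IsoS : Strip → Strip → Type} {Mv : ∀ v : (thetaIndex X).V, v ∈ (thetaIndex X).Vbad → Type}
  [∀ v h, Monoid (Mv v h)]
  (sig : GlobalLGPFrobenioidSignature (thetaIndex X).lstar (thetaIndex X).V (· ∈ (thetaIndex X).Vbad)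
    Frd IsoF Ob realify Strip IsoS Mv)
  (split : SplittingMonoids Mv) {ObΔ : Type} {N : ∀ v : (thetaIndex X).V, v ∈ (thetaIndex X).Vbad → Type}
  [∀ v h, Monoid (N v h)] (qData : QPilotData ObΔ N)
  (tq : ∀ (pp : Nat.Primes) (x : (thetaIndex X).Fibre (.inr pp)), haveI : Fact (pp : ℕ).Prime := ⟨pp.2⟩; kOf X pp.1 x)
  (t : ∀ (pp : Nat.Primes) (_ : Fin X.lstar) (x : (thetaIndex X).Fibre (.inr pp)),
    haveI : Fact (pp : ℕ).Prime := ⟨pp.2⟩; kOf X pp.1 x)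
  (htq0 : ∀ pp x, tq pp x ≠ 0)
  (htq1 : ∀ (pp : Nat.Primes) (x : (thetaIndex X).Fibre (.inr pp)),
    haveI : Fact (pp : ℕ).Prime := ⟨pp.2⟩; placeOf X pp.1 x ∉ X.S → ‖tq pp x‖ = 1)

/-! ## 1. An (Ind2)-family acting on ALL tensor slots, and its effect on pure tensors -/


/-- The holomorphic hull `ⁿ˒°𝒰_{j,v_ℚ}` of abc-iut-c312-1's `settingPrVol` does not read the q-centre binder (the hull frame and
the possible images are built from the Θ-boxes alone). [folklore] -/
theorem thetaHull_settingPrVol_eq_of_qCentre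
    (thetaBox : ℤ → Ob sig.Clgp → ∀ (j : (thetaIndex X).Label) (vQ : (thetaIndex X).VQ),
      Set (∀ s : factorIdxDH X hlog j vQ, factorFieldDH X hlog j vQ s))
    (qCentre qCentre' : ObΔ → ∀ (j : (thetaIndex X).Label) (vQ : (thetaIndex X).VQ),
      ∀ s : factorIdxDH X hlog j vQ, factorFieldDH X hlog j vQ s)
    (hq : ∀ j vQ s, qCentre (qPilotObject qData) j vQ s ≠ 0)
    (hq' : ∀ j vQ s, qCentre' (qPilotObject qData) j vQ s ≠ 0)
    (hfin : ∀ j : (thetaIndex X).Label, (Function.support fun vQ =>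
      ((situationPrVol X hlog M archPk archSub Ψ act Mmod region).D n).logvol j vQ
        (factorMapDH X hlog j vQ ⁻¹' hullSet (factorFieldDH X hlog j vQ) (qCentre (qPilotObject qData) j vQ))).Finite)
    (hfin' : ∀ j : (thetaIndex X).Label, (Function.support fun vQ =>
      ((situationPrVol X hlog M archPk archSub Ψ act Mmod region).D n).logvol j vQ
        (factorMapDH X hlog j vQ ⁻¹' hullSet (factorFieldDH X hlog j vQ) (qCentre' (qPilotObject qData) j vQ))).Finite)
    (j : (thetaIndex X).Label) (vQ : (thetaIndex X).VQ) :
    (settingPrVol X hlog M archPk archSub Ψ act Mmod region n lat sig split qData thetaBox qCentre' hq' hfin').thetaHull j vQ =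
      (settingPrVol X hlog M archPk archSub Ψ act Mmod region n lat sig split qData thetaBox qCentre hq hfin).thetaHull j vQ :=
  rfl

/-- Hence the holomorphic hull `ⁿ˒°𝒰_{j,v_ℚ}` of abc-iut-c312-7's `settingPrVolSharp` does not depend on the q-pilot idele. [folklore] -/
theorem thetaHull_settingPrVolSharp_eq
    (tq' : ∀ (pp : Nat.Primes) (x : (thetaIndex X).Fibre (.inr pp)), haveI : Fact (pp : ℕ).Prime := ⟨pp.2⟩; kOf X pp.1 x)
    (htq0' : ∀ pp x, tq' pp x ≠ 0)
    (htq1' : ∀ (pp : Nat.Primes) (x : (thetaIndex X).Fibre (.inr pp)),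
      haveI : Fact (pp : ℕ).Prime := ⟨pp.2⟩; placeOf X pp.1 x ∉ X.S → ‖tq' pp x‖ = 1)
    (j : (thetaIndex X).Label) (vQ : (thetaIndex X).VQ) :
    (settingPrVolSharp X hlog M archPk archSub Ψ act Mmod region n lat sig split qData tq' t htq0' htq1').thetaHull j vQ =
      (settingPrVolSharp X hlog M archPk archSub Ψ act Mmod region n lat sig split qData tq t htq0 htq1).thetaHull j vQ :=
  thetaHull_settingPrVol_eq_of_qCentre X hlog M archPk archSub Ψ act Mmod region n lat sig split qData
    (fun _ _ => thetaBoxDH X hlog (sharpBoxDH X hlog t)) (fun _ => qCentreDH X hlog tq) (fun _ => qCentreDH X hlog tq')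
    (qCentreDH_ne_zero X hlog tq htq0) (qCentreDH_ne_zero X hlog tq' htq0')
    (finite_support_logvol_qRegion_Pr X hlog M archPk archSub Ψ act Mmod region n tq htq0 htq1)
    (finite_support_logvol_qRegion_Pr X hlog M archPk archSub Ψ act Mmod region n tq' htq0' htq1') j vQ

/-- **REACHED q-VOLUME ≤ HULL VOLUME.** At the print-normalised sharp bed `settingPrVolSharp`, packet `(i+1, p)`: if an idele
`t_q'` (nonzero, units off `S`) is MULTI-REACHED by the (Ind2)-movers — for every summand `v⃗`, movers `g_a ∈ Ism_{v_a}` and integers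
`y_a` with `‖t_q'(v_{i+1})‖ ≤ Π_a ‖g_a(c_a·y_a)‖`, `c_{i+1} = t_{Θ,i+1,v_{i+1}}`, `c_a = 1` otherwise (abc-iut-w5-d107's hypothesis
verbatim, with `t_q'` for `t_q`) — then `Σ_{v⃗} Pr(v⃗)·log ‖t_q'(v_{i+1})‖ ≤ logvol(ⁿ˒°𝒰_{i+1,p})`, given monotone log-volume and
`ThetaFinite` at the bed. [cite: DupuyHilado2025, §3.9, §4.9] [claim: Mochizuki2012, status: disputed] -/
theorem reachedQVolume_le_logvol_thetaHull (pp : Nat.Primes) (i : Fin (thetaIndex X).lstar)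
    (tq' : ∀ (pp : Nat.Primes) (x : (thetaIndex X).Fibre (.inr pp)), haveI : Fact (pp : ℕ).Prime := ⟨pp.2⟩; kOf X pp.1 x)
    (htq0' : ∀ pp x, tq' pp x ≠ 0)
    (htq1' : ∀ (pp : Nat.Primes) (x : (thetaIndex X).Fibre (.inr pp)),
      haveI : Fact (pp : ℕ).Prime := ⟨pp.2⟩; placeOf X pp.1 x ∉ X.S → ‖tq' pp x‖ = 1)
    (hreach : haveI : Fact (pp : ℕ).Prime := ⟨pp.2⟩
      ∀ e : (thetaIndex X).Caps (Setting.labelSucc i) → (thetaIndex X).Fibre (.inr pp),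
        ∃ g : (thetaIndex X).Caps (Setting.labelSucc i) → ∀ x : (thetaIndex X).Fibre (.inr pp),
            (logShellsDH X logv).carrier x.1 ≃ₗ[ℚ] (logShellsDH X logv).carrier x.1,
          (∀ a x, g a x ∈ (logShellsDH X logv).ism x.1) ∧
          ∃ y : ∀ a, kOf X pp.1 (e a), (∀ a, ‖y a‖ ≤ 1) ∧
            ‖tq' pp (e (Fin.last _))‖ ≤ ∏ a, ‖(presAt X hlog pp).φ (e a) (g a (e a) (((presAt X hlog pp).φ (e a)).symm
              ((if a = Fin.last _ then t pp i (e a) else 1) * y a)))‖)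
    (hmono : LogvolMono (settingPrVolSharp X hlog M archPk archSub Ψ act Mmod region n lat sig split qData tq t htq0 htq1))
    (hfin : (settingPrVolSharp X hlog M archPk archSub Ψ act Mmod region n lat sig split qData tq t htq0 htq1).ThetaFinite) :
    haveI : Fact (pp : ℕ).Prime := ⟨pp.2⟩
    (∑ e : (presAt X hlog pp).toLocalPieces.E (Setting.labelSucc i),
        weightPr X pp.1 (Setting.labelSucc i) e * Real.log ‖tq' pp (e (Fin.last _))‖) ≤
      ((situationPrVol X hlog M archPk archSub Ψ act Mmod region).D n).logvol (Setting.labelSucc i) (.inr pp)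
        ((settingPrVolSharp X hlog M archPk archSub Ψ act Mmod region n lat sig split qData tq t htq0 htq1).thetaHull
          (Setting.labelSucc i) (.inr pp)) := by
  haveI : Fact (pp : ℕ).Prime := ⟨pp.2⟩
  have hsub : (settingPrVolSharp X hlog M archPk archSub Ψ act Mmod region n lat sig split qData tq' t htq0' htq1').qRegion
        (Setting.labelSucc i) (.inr pp) ⊆
      (settingPrVolSharp X hlog M archPk archSub Ψ act Mmod region n lat sig split qData tq' t htq0' htq1').thetaHull
        (Setting.labelSucc i) (.inr pp) :=
    qRegion_subset_thetaHull_settingDHVolSharp_of_multiReach X hlog M archPk archSub Ψ act Mmod region n lat sig split qData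
      tq' t htq0' htq1' pp i hreach
  rw [thetaHull_settingPrVolSharp_eq X hlog M archPk archSub Ψ act Mmod region n lat sig split qData tq t htq0 htq1 tq' htq0'
    htq1'] at hsub
  have hq : (settingPrVolSharp X hlog M archPk archSub Ψ act Mmod region n lat sig split qData tq' t htq0' htq1').qLocal
        (Setting.labelSucc i) (.inr pp) =
      ∑ e : (presAt X hlog pp).toLocalPieces.E (Setting.labelSucc i),
        weightPr X pp.1 (Setting.labelSucc i) e * Real.log ‖tq' pp (e (Fin.last _))‖ :=
    logvol_qRegion_Pr_inr X hlog M archPk archSub Ψ act Mmod region n tq' htq0' (Setting.labelSucc i) pp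
  rw [← hq]
  exact hmono i (.inr pp)
    ((settingPrVolSharp X hlog M archPk archSub Ψ act Mmod region n lat sig split qData tq' t htq0' htq1').hul_adm _ _ _
      ((settingPrVolSharp X hlog M archPk archSub Ψ act Mmod region n lat sig split qData tq' t htq0' htq1').qRegion_mem _ _))
    ((settingPrVolSharp X hlog M archPk archSub Ψ act Mmod region n lat sig split qData tq t htq0 htq1).thetaHull_adm
      (Cor312Vol.hullDefined_of_thetaFinite hfin i (.inr pp))) hsub


/-! ## §2. L1 — the REACH GAIN is a lower bound for the CELL SLACK `σ_{i+1,p} = logvol(ⁿ˒°𝒰_{i+1,p}) − qLocal_{i+1,p}` -/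

/-- **L1, VOLUME FORM («mover reach ⟹ cell slack»).** At `settingPrVolSharp`, packet `(i+1, p)`: if an idele `t_q'` is
multi-reached by the (Ind2)-movers (as in `reachedQVolume_le_logvol_thetaHull`), then the REACH GAIN in volume currency,
`Σ_{v⃗} Pr(v⃗)·(log ‖t_q'(v_{i+1})‖ − log ‖t_q(v_{i+1})‖)`, is at most the cell slack
`logvol(ⁿ˒°𝒰_{i+1,p}) − qLocal_{i+1,p}` of abc-iut-rp-s2's `Repair.ObstructionSS28Window` (spelled out; `qLocal` read off
`logvol_qRegion_Pr_inr`). A deficit (`‖t_q'‖ < ‖t_q‖`) is a negative gain. [cite: DupuyHilado2025, §3.9, §4.9]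
[claim: Mochizuki2012, status: disputed] -/
theorem reachGain_le_cellSlack (pp : Nat.Primes) (i : Fin (thetaIndex X).lstar)
    (tq' : ∀ (pp : Nat.Primes) (x : (thetaIndex X).Fibre (.inr pp)), haveI : Fact (pp : ℕ).Prime := ⟨pp.2⟩; kOf X pp.1 x)
    (htq0' : ∀ pp x, tq' pp x ≠ 0)
    (htq1' : ∀ (pp : Nat.Primes) (x : (thetaIndex X).Fibre (.inr pp)),
      haveI : Fact (pp : ℕ).Prime := ⟨pp.2⟩; placeOf X pp.1 x ∉ X.S → ‖tq' pp x‖ = 1)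
    (hreach : haveI : Fact (pp : ℕ).Prime := ⟨pp.2⟩
      ∀ e : (thetaIndex X).Caps (Setting.labelSucc i) → (thetaIndex X).Fibre (.inr pp),
        ∃ g : (thetaIndex X).Caps (Setting.labelSucc i) → ∀ x : (thetaIndex X).Fibre (.inr pp),
            (logShellsDH X logv).carrier x.1 ≃ₗ[ℚ] (logShellsDH X logv).carrier x.1,
          (∀ a x, g a x ∈ (logShellsDH X logv).ism x.1) ∧
          ∃ y : ∀ a, kOf X pp.1 (e a), (∀ a, ‖y a‖ ≤ 1) ∧
            ‖tq' pp (e (Fin.last _))‖ ≤ ∏ a, ‖(presAt X hlog pp).φ (e a) (g a (e a) (((presAt X hlog pp).φ (e a)).symm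
              ((if a = Fin.last _ then t pp i (e a) else 1) * y a)))‖)
    (hmono : LogvolMono (settingPrVolSharp X hlog M archPk archSub Ψ act Mmod region n lat sig split qData tq t htq0 htq1))
    (hfin : (settingPrVolSharp X hlog M archPk archSub Ψ act Mmod region n lat sig split qData tq t htq0 htq1).ThetaFinite) :
    haveI : Fact (pp : ℕ).Prime := ⟨pp.2⟩
    (∑ e : (presAt X hlog pp).toLocalPieces.E (Setting.labelSucc i),
        weightPr X pp.1 (Setting.labelSucc i) e *
          (Real.log ‖tq' pp (e (Fin.last _))‖ - Real.log ‖tq pp (e (Fin.last _))‖)) ≤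
      ((situationPrVol X hlog M archPk archSub Ψ act Mmod region).D n).logvol (Setting.labelSucc i) (.inr pp)
          ((settingPrVolSharp X hlog M archPk archSub Ψ act Mmod region n lat sig split qData tq t htq0 htq1).thetaHull (Setting.labelSucc i) (.inr pp)) -
        (settingPrVolSharp X hlog M archPk archSub Ψ act Mmod region n lat sig split qData tq t htq0 htq1).qLocal (Setting.labelSucc i) (.inr pp) := by
  haveI : Fact (pp : ℕ).Prime := ⟨pp.2⟩
  have h := reachedQVolume_le_logvol_thetaHull X hlog M archPk archSub Ψ act Mmod region n lat sig split qData tq t htq0 htq1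
    pp i tq' htq0' htq1' hreach hmono hfin
  have hq : (settingPrVolSharp X hlog M archPk archSub Ψ act Mmod region n lat sig split qData tq t htq0 htq1).qLocal (Setting.labelSucc i) (.inr pp) =
      ∑ e : (presAt X hlog pp).toLocalPieces.E (Setting.labelSucc i),
        weightPr X pp.1 (Setting.labelSucc i) e * Real.log ‖tq pp (e (Fin.last _))‖ :=
    logvol_qRegion_Pr_inr X hlog M archPk archSub Ψ act Mmod region n tq htq0 (Setting.labelSucc i) pp
  rw [hq]
  simp only [mul_sub, Finset.sum_sub_distrib]
  exact sub_le_sub_right h _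

/-- **L1, INTEGER («LEVELS») FORM — the CARD's statement.** If, at every `x ∣ p`, the reached idele sits `s_x` `w`-units
(`s_x ∈ ℤ`; `s_x < 0` a deficit) beyond the q-pilot coordinate, `‖t_q'(x)‖ = ‖t_q(x)‖·p^{s_x/e_x}` with `e_x ≥ 1` the unit of
account (the absolute ramification index in row 27's dictionary), then `log p · Σ_{v⃗} Pr(v⃗)·⌊s/e⌋(v_{i+1}) ≤ σ_{i+1,p}`
(`Pr ≥ 0`, `⌊s/e⌋ ≤ s/e`, `log p ≥ 0`). Whole `p`-levels are row 27's conservative currency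
(`Repair.RH.ReachLedger.cellLevels`). [cite: DupuyHilado2025, §3.6, §3.9] [claim: Mochizuki2012, status: disputed] -/
theorem levels_le_cellSlack (pp : Nat.Primes) (i : Fin (thetaIndex X).lstar)
    (tq' : ∀ (pp : Nat.Primes) (x : (thetaIndex X).Fibre (.inr pp)), haveI : Fact (pp : ℕ).Prime := ⟨pp.2⟩; kOf X pp.1 x)
    (htq0' : ∀ pp x, tq' pp x ≠ 0)
    (htq1' : ∀ (pp : Nat.Primes) (x : (thetaIndex X).Fibre (.inr pp)),
      haveI : Fact (pp : ℕ).Prime := ⟨pp.2⟩; placeOf X pp.1 x ∉ X.S → ‖tq' pp x‖ = 1)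
    (hreach : haveI : Fact (pp : ℕ).Prime := ⟨pp.2⟩
      ∀ e : (thetaIndex X).Caps (Setting.labelSucc i) → (thetaIndex X).Fibre (.inr pp),
        ∃ g : (thetaIndex X).Caps (Setting.labelSucc i) → ∀ x : (thetaIndex X).Fibre (.inr pp),
            (logShellsDH X logv).carrier x.1 ≃ₗ[ℚ] (logShellsDH X logv).carrier x.1,
          (∀ a x, g a x ∈ (logShellsDH X logv).ism x.1) ∧
          ∃ y : ∀ a, kOf X pp.1 (e a), (∀ a, ‖y a‖ ≤ 1) ∧
            ‖tq' pp (e (Fin.last _))‖ ≤ ∏ a, ‖(presAt X hlog pp).φ (e a) (g a (e a) (((presAt X hlog pp).φ (e a)).symm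
              ((if a = Fin.last _ then t pp i (e a) else 1) * y a)))‖)
    (hmono : LogvolMono (settingPrVolSharp X hlog M archPk archSub Ψ act Mmod region n lat sig split qData tq t htq0 htq1))
    (hfin : (settingPrVolSharp X hlog M archPk archSub Ψ act Mmod region n lat sig split qData tq t htq0 htq1).ThetaFinite)
    (eIdx : (thetaIndex X).Fibre (.inr pp) → ℕ) (heIdx : ∀ x, 1 ≤ eIdx x) (s : (thetaIndex X).Fibre (.inr pp) → ℤ)
    (hnorm : haveI : Fact (pp : ℕ).Prime := ⟨pp.2⟩
      ∀ x, ‖tq' pp x‖ = ‖tq pp x‖ * ((pp : ℕ) : ℝ) ^ ((s x : ℝ) / (eIdx x : ℝ))) :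
    haveI : Fact (pp : ℕ).Prime := ⟨pp.2⟩
    Real.log ((pp : ℕ) : ℝ) * (∑ e : (presAt X hlog pp).toLocalPieces.E (Setting.labelSucc i),
        weightPr X pp.1 (Setting.labelSucc i) e * (((s (e (Fin.last _)) / (eIdx (e (Fin.last _)) : ℤ) : ℤ) : ℝ))) ≤
      ((situationPrVol X hlog M archPk archSub Ψ act Mmod region).D n).logvol (Setting.labelSucc i) (.inr pp)
          ((settingPrVolSharp X hlog M archPk archSub Ψ act Mmod region n lat sig split qData tq t htq0 htq1).thetaHull (Setting.labelSucc i) (.inr pp)) -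
        (settingPrVolSharp X hlog M archPk archSub Ψ act Mmod region n lat sig split qData tq t htq0 htq1).qLocal (Setting.labelSucc i) (.inr pp) := by
  haveI : Fact (pp : ℕ).Prime := ⟨pp.2⟩
  refine le_trans ?_ (reachGain_le_cellSlack X hlog M archPk archSub Ψ act Mmod region n lat sig split qData tq t htq0 htq1
    pp i tq' htq0' htq1' hreach hmono hfin)
  rw [Finset.mul_sum]
  refine Finset.sum_le_sum fun e _ => ?_
  have hp : (0 : ℝ) < ((pp : ℕ) : ℝ) := by exact_mod_cast pp.2.pos
  have hlogp : 0 ≤ Real.log ((pp : ℕ) : ℝ) := Real.log_nonneg (by exact_mod_cast pp.2.one_lt.le)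
  have htqpos : 0 < ‖tq pp (e (Fin.last _))‖ := norm_pos_iff.mpr (htq0 pp _)
  have hgain : Real.log ‖tq' pp (e (Fin.last _))‖ - Real.log ‖tq pp (e (Fin.last _))‖ =
      (s (e (Fin.last _)) : ℝ) / (eIdx (e (Fin.last _)) : ℝ) * Real.log ((pp : ℕ) : ℝ) := by
    rw [hnorm, Real.log_mul htqpos.ne' (Real.rpow_pos_of_pos hp _).ne', Real.log_rpow hp]
    ring
  have hfloor : ((s (e (Fin.last _)) / (eIdx (e (Fin.last _)) : ℤ) : ℤ) : ℝ) ≤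
      (s (e (Fin.last _)) : ℝ) / (eIdx (e (Fin.last _)) : ℝ) := by
    have he : (0 : ℝ) < (eIdx (e (Fin.last _)) : ℝ) := by exact_mod_cast heIdx _
    rw [le_div_iff₀ he]
    have hne : ((eIdx (e (Fin.last _)) : ℕ) : ℤ) ≠ 0 := by exact_mod_cast Nat.pos_iff_ne_zero.mp (heIdx _)
    exact_mod_cast Int.ediv_mul_le (s (e (Fin.last _))) hne
  rw [hgain]
  have key := mul_le_mul_of_nonneg_left (mul_le_mul_of_nonneg_right hfloor hlogp)
    (weightPr_nonneg X pp.1 (Setting.labelSucc i) e)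
  linarith [key]

end Summit.ABC.IUTFork.Repair.RH.ReachLedgerVolume

end
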